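import Mathlib
import HarnessLib.Audit
import Summits.PneNP.PneNP.Theorems.PstarTipsPeel

/-!
# PLAN B for the fresh class: the tips chain reduces to the hanging bound (ROUND-24, memo §14.6 (T2)–(T4))

FRONTIER range-avoidance ladder, rung F-N3, ROUND 24 (cell `pnp-ideate`, planner memo `r24/CORE-BOUND-NOTES.md` §14.6 TIPS CHAIN; restricted-model proof
complexity — nothing here bears on `P` versus `NP`).

PEEL all the way (memo (T4)): deleting XOR tips one by one and substituting them into their readers (`PstarTipsPeel.terminalNC_peel`) ends at the XOR
core `xcore I M`, which — if non-empty — is a TERMINAL core (`PstarCoreBoundTargets.Terminal`) for the peeled pair; the new monomials are the peeled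
outputs, which never touch a chord private (a private is used once in `M`), so privates stay unread and the LANDED chain
(`PstarCoreBoundTargets.card_le_five_of_terminal'`) bounds the core by five.  What is left is the size of the HANGING part `M ∖ xcore I M`
(memo (T2) "no free leaf", (T3) "paths fold"), typed here as the open node `HangingBound h`:

* `core_terminal` — `TerminalNC` + chords ⟹ `xcore I M = ∅` or `xcore I M` is `Terminal` for a peeled pair whose monomials are original monomials
  or members of `M ∖ xcore I M`;
* `card_xcore_le_five` — hence `#(xcore I M) ≤ 5` under Assumption-A data and privates unread;
* `HangingBound h` (OPEN, `@[conjecture]`) — `#(M ∖ xcore I M) ≤ h` for such cores (memo: `h = 2`, CONS-T path shape);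
* `tipsChain_of_hangingBound : HangingBound h → TipsChainBound (5 + h)` — so `HangingBound 2` gives the tips chain with `c = 7`, the union bound
  `14`, and the fresh class of O2 with constant `14` (`PstarUnionCovers.terminalFresh_le_of_tipsChain`).
-/

set_option linter.dupNamespace false -- `Summit.PneNP.PneNP.…`: summit = sub-problem name (D-0017 single-conjunct layout)

open Finset Literature.Computability.Complexity
open Summit.PneNP.PneNP.Theorems.PstarTyped (Typed)
open Summit.PneNP.PneNP.Theorems.PstarSALevel (varSet bdry BoundaryExpanding SimpleOverlap)
open Summit.PneNP.PneNP.Theorems.PstarGapPeeling (not_mem_varSet_of_private)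
open Summit.PneNP.PneNP.Theorems.PstarCentreFree (vars_mem_varSet)
open Summit.PneNP.PneNP.Theorems.PstarGapOneAll (gval)
open Summit.PneNP.PneNP.Theorems.PstarCoreBound (XorClosed)
open Summit.PneNP.PneNP.Theorems.PstarChordRepair (IsChord)
open Summit.PneNP.PneNP.Theorems.PstarChordBridgeCotree (Peelable)
open Summit.PneNP.PneNP.Theorems.PstarChordBridgeTools (privs mem_privs)
open Summit.PneNP.PneNP.Theorems.PstarChordBridgeCentre (exists_maximal_peelable_sup)
open Summit.PneNP.PneNP.Theorems.PstarNorUnitDirAssembly (mem_bdry_of_subset)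
open Summit.PneNP.PneNP.Theorems.PstarCoreBoundTargets (Terminal card_le_five_of_terminal')
open Summit.PneNP.PneNP.Theorems.PstarUnion (SatPair)
open Summit.PneNP.PneNP.Theorems.PstarUnionCovers (TerminalNC TipsChainBound)
open Summit.PneNP.PneNP.Theorems.PstarTipsPeel

namespace Summit.PneNP.PneNP.Theorems.PstarTipsChain

variable {n m : ℕ}

/-! ## Peeling down to the core -/

/-- **PEEL ALL THE WAY.**  A `TerminalNC` core `M ⊆ M₀` for a pair whose monomials are original (`G₀`) or deleted members of `M₀` peels to its XOR
core: `xcore I M = ∅`, or `xcore I M` is `Terminal` for a pair with the same kind of monomials. -/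
theorem core_terminal (I : LocalMap 4 n m) (hI : I.IsPure xorAndPred) (hT : Typed I) {r : ℕ} (y : Fin m → Bool) (M₀ G₀ : Finset (Fin m)) :
    ∀ (k : ℕ) (M : Finset (Fin m)) (A w : Finset (Fin n) × Finset (Fin m) × Bool), M.card ≤ k → M ⊆ M₀ → TerminalNC I r y M A w →
      A.2.1 ∪ w.2.1 ⊆ G₀ ∪ (M₀ \ M) →
      xcore I M = ∅ ∨ ∃ A' w' : Finset (Fin n) × Finset (Fin m) × Bool, Terminal I r y (xcore I M) A' w' ∧
        A'.2.1 ∪ w'.2.1 ⊆ G₀ ∪ (M₀ \ xcore I M) := by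
  classical
  intro k
  induction k with
  | zero =>
    intro M A w hk _ ht _
    exact absurd (card_pos.2 ht.1) (by omega)
  | succ k ih =>
    intro M A w hk hM ht hG
    by_cases hX : XorClosed I M
    · refine Or.inr ⟨A, w, ?_, ?_⟩
      · obtain ⟨hne, hMr, hdA, hdw, hr, hT3, hM0⟩ := ht
        rw [xcore_eq_of_xorClosed I hX]
        exact ⟨hne, hX, hMr, hdA, hdw, hr, hT3, hM0⟩
      · rw [xcore_eq_of_xorClosed I hX]
        exact hG
    · obtain ⟨g, hg, s, hs, htip⟩ := exists_tip I hX
      rw [← xcore_erase_tip I hg hs htip]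
      rcases (M.erase g).eq_empty_or_nonempty with hE | hne
      · left
        rw [hE, xcore_empty]
      · have ht' := terminalNC_peel I hI hT y ht hg hs htip hne
        refine ih (M.erase g) _ _ (by rw [card_erase_of_mem hg]; omega) ((erase_subset g M).trans hM) ht' ?_
        intro j hj
        have hj' : j ∈ insert g (A.2.1 ∪ w.2.1) := by
          rcases mem_union.1 hj with h | h
          · rcases mem_insert.1 (peelK_monomials_subset I y g _ A h) with rfl | h
            · exact mem_insert_self _ _
            · exact mem_insert_of_mem (mem_union_left _ h)
          · rcases mem_insert.1 (peelK_monomials_subset I y g _ w h) with rfl | h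
            · exact mem_insert_self _ _
            · exact mem_insert_of_mem (mem_union_right _ h)
        rcases mem_insert.1 hj' with rfl | hj'
        · exact mem_union_right _ (mem_sdiff.2 ⟨hM hg, notMem_erase _ _⟩)
        · rcases mem_union.1 (hG hj') with h | h
          · exact mem_union_left _ h
          · exact mem_union_right _ (mem_sdiff.2 ⟨(mem_sdiff.1 h).1, fun h' => (mem_sdiff.1 h).2 (mem_of_mem_erase h')⟩)

/-- **The XOR core of a `TerminalNC` core has at most five outputs** (Assumption-A data + privates unread; the landed chain on the peeled pair). -/
theorem card_xcore_le_five (I : LocalMap 4 n m) (hI : I.IsPure xorAndPred) (hT : Typed I) (hS : SimpleOverlap I) {r : ℕ}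
    (hB : BoundaryExpanding r I) (y : Fin m → Bool) {M : Finset (Fin m)} {A w : Finset (Fin n) × Finset (Fin m) × Bool}
    (ht : TerminalNC I r y M A w) {F : Finset (Fin m)} (hP : Peelable I F) (hchord : ∀ e ∈ M \ F, IsChord I M e)
    (hun : ∀ g ∈ A.2.1 ∪ w.2.1, ∀ v ∈ privs I (M \ F), I.vars g 2 ≠ v ∧ I.vars g 3 ≠ v) : (xcore I M).card ≤ 5 := by
  classical
  rcases core_terminal I hI hT y M (A.2.1 ∪ w.2.1) M.card M A w le_rfl (Subset.refl M) ht (subset_union_left) with h0 | ⟨A', w', ht', hG'⟩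
  · rw [h0, card_empty]; omega
  -- Assumption-A data for the core
  have hcM := xcore_subset I M
  obtain ⟨F', hFF', hF'c, hPF', hmax'⟩ :=
    exists_maximal_peelable_sup I (inter_subset_right : F ∩ xcore I M ⊆ xcore I M) (hP.subset inter_subset_left)
  refine card_le_five_of_terminal' I hI hT hS hB y ht' hF'c hPF' hmax' (fun e he => ?_) (fun g hg v hv => ?_)
  · rw [mem_sdiff] at he
    have heF : e ∉ F := fun h => he.2 (hFF' (mem_inter.2 ⟨h, he.1⟩))
    obtain ⟨h2, h3⟩ := hchord e (mem_sdiff.2 ⟨hcM he.1, heF⟩)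
    exact ⟨mem_bdry_of_subset I hcM he.1 (vars_mem_varSet I e 2) h2, mem_bdry_of_subset I hcM he.1 (vars_mem_varSet I e 3) h3⟩
  · -- `v` is a private of a chord `e` of the core
    obtain ⟨e, he, hev⟩ := (mem_privs I).1 hv
    rw [mem_sdiff] at he
    have heF : e ∉ F := fun h => he.2 (hFF' (mem_inter.2 ⟨h, he.1⟩))
    rcases mem_union.1 (hG' hg) with h | h
    · exact hun g h v ((mem_privs I).2 ⟨e, mem_sdiff.2 ⟨hcM he.1, heF⟩, hev⟩)
    · -- a peeled output: it is a member of `M` other than `e`, and `v` is private in `M`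
      rw [mem_sdiff] at h
      have hge : g ≠ e := fun h' => h.2 (h' ▸ he.1)
      obtain ⟨hb2, hb3⟩ := hchord e (mem_sdiff.2 ⟨hcM he.1, heF⟩)
      have hvb : v ∈ bdry I M := by rcases hev with rfl | rfl; exacts [hb2, hb3]
      have hve : v ∈ varSet I e := by rcases hev with rfl | rfl; exacts [vars_mem_varSet I e 2, vars_mem_varSet I e 3]
      have hvg : v ∉ varSet I g := not_mem_varSet_of_private I (hcM he.1) h.1 hge hvb hve
      exact ⟨fun h' => hvg (h' ▸ vars_mem_varSet I g 2), fun h' => hvg (h' ▸ vars_mem_varSet I g 3)⟩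

/-! ## The hanging bound and the tips chain -/

/-- **HANGING BOUND (OPEN; memo §14.6 (T2) "no free leaf", (T3) "paths fold"; expected `h = 2`):** a `TerminalNC` core with Assumption-A data and
privates unread has at most `h` outputs outside its XOR core.  FRONTIER. -/
@[conjecture] def HangingBound (h : ℕ) : Prop :=
  ∀ (n m r : ℕ) (I : LocalMap 4 n m), I.IsPure xorAndPred → Typed I → SimpleOverlap I → BoundaryExpanding r I →
    ∀ (y : Fin m → Bool) (M : Finset (Fin m)) (A w : Finset (Fin n) × Finset (Fin m) × Bool), TerminalNC I r y M A w →
    ∀ F ⊆ M, Peelable I F → (∀ F', F ⊆ F' → F' ⊆ M → Peelable I F' → F' = F) → (∀ e ∈ M \ F, IsChord I M e) →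
    (∀ g ∈ A.2.1 ∪ w.2.1, ∀ v ∈ privs I (M \ F), I.vars g 2 ≠ v ∧ I.vars g 3 ≠ v) → (M \ xcore I M).card ≤ h

/-- **The tips chain from the hanging bound: `HangingBound h → TipsChainBound (5 + h)`.** -/
theorem tipsChain_of_hangingBound (h : ℕ) (hH : HangingBound h) : TipsChainBound (5 + h) := by
  intro n m r I hI hT hS hB y M A w ht F hF hP hmax hchord hun
  classical
  have h1 := card_xcore_le_five I hI hT hS hB y ht hP hchord hun
  have h2 := hH n m r I hI hT hS hB y M A w ht F hF hP hmax hchord hun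
  have h3 : M.card = (xcore I M).card + (M \ xcore I M).card := by
    rw [← card_union_of_disjoint disjoint_sdiff, union_sdiff_of_subset (xcore_subset I M)]
  omega

end Summit.PneNP.PneNP.Theorems.PstarTipsChain
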